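import Mathlib
import HarnessLib
import Summits.AnomalousDissipation.AnomalousDissipation.Theses.WazewskiBlock
import Literature.Analysis.FluidPDE.GalerkinFlow
import Literature.Analysis.FluidPDE.NSGalerkinTrajectory
import Summits.AnomalousDissipation.AnomalousDissipation.Theorems.WazewskiBlockUniformWorkFloorTrapStubSteadyTransfer
import Summits.AnomalousDissipation.AnomalousDissipation.Theorems.WazewskiBlockUniformWorkFloorTrapStubFiniteHorizon
import Summits.AnomalousDissipation.AnomalousDissipation.Theorems.WazewskiBlockUniformWorkFloorTrapStubWorkFallRate

/-!
# Line `Sketch` — crux `WazewskiBlock.UniformWorkFloorTrap` (stmt-AnomalousDissipation-10353)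

Lead skeleton (prover-line-stmt-AnomalousDissipation-10353-0, 2026-08-16), reshaped from the two checked
crux-ideate sketches (`SketchIdeator1.lean`, `SketchIdeator2.lean`; cards `rybakowski-descent-kills-n`,
`boundary-degree-readout`, `work-lipschitz-cycles`, `small-hole-survivor-closing`,
`ekman-homotopy-laminar-handoff`), which all share ONE composition and differ only in the object
that is to supply the core hypothesis.

THE LINE. The crux asks, for one mean-zero trig-polynomial force `f`, constants `E, ε₀ > 0` and every
small viscosity `ν`, for a global Galerkin trajectory of EVERY large order `N` staying in the block
`B = {kineticEnergy ≤ E} ∩ {(f, ·) ≥ ε₀}` for all `t ≥ 0`. Clauses (1)–(4) of the crux's `∃ U`-body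
(joint continuity, Galerkin + weakly div-free slices, tested Galerkin equations, exact energy identity)
are exactly `Literature.Analysis.FluidPDE.Torus.IsGalerkinTrajectory` (`isGalerkinTrajectory_iff`) and
hold for every forward orbit of the Galerkin semiflow `Torus.galerkinFlow ν f N`
(`IsGalerkinMode.galerkinFlow_clauses`, PROVED in Literature); the whole content is the block clause (5).
The composition therefore is:

  crux ⇐ per `(ν, N)`: a LOUD BOUNDED GALERKIN STEADY STATE (tested steady equations, `KE ≤ E`,
        `(f,U) ≥ ε₀`; the witnesses of cards `boundary-degree-readout` / `rybakowski-descent-kills-n`)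
        OR arbitrarily long LOUD BOUNDED SOJOURNS of `galerkinFlow` orbits in `B` (the witnesses of
        cards `small-hole-survivor-closing` / `work-lipschitz-cycles`: periodic or chaotic loud orbits)
     ⇐ `stub_steadyTransfer` (a steady state is the constant trapped trajectory) and
        `stub_finiteHorizon` (compactness of `B` in the finite-dimensional phase space: sojourns of every
        finite length ⇒ one infinite sojourn, i.e. the crux at `(ν, N)` ⟺ `sup` exit time `= ∞`).

Registered stubs (def-free signatures; `theorem stub_<name> : … := by sorry`; the composition
`UniformWorkFloorTrap_of` concludes the route decl BY NAME with sorries only inside `stub_*`):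
* `stub_loudGalerkinFamily` (open-problem class, HARDEST, held by the lead) — the `ν`-uniform family of
  loud bounded Galerkin steady states or loud bounded finite sojourns, `∀ ν ≤ ν₀ ∃ N₀ ∀ N ≥ N₀`.
* `stub_steadyTransfer` (M) — loud bounded Galerkin steady state ⇒ trapped constant trajectory.
  LANDED (wave 1, p103729): `Theorems/WazewskiBlockUniformWorkFloorTrapStubSteadyTransfer.lean`, wired below.
* `stub_finiteHorizon` (M/L) — finite-horizon principle for `galerkinFlow` on the block `B`.
  LANDED (wave 1, p104099): `Theorems/WazewskiBlockUniformWorkFloorTrapStubFiniteHorizon.lean`, wired below.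
* `stub_workFallRate` (M) — the work functional `(f, U t)` falls no faster than the stress budget `D`
  along a Galerkin trajectory inside `{KE ≤ E}` (tested identity with `a := f`); the `ν`-, `N`-free
  modulus by which clause (5) is certified from finitely many samples (`workFloor_of_earlier`,
  `sojourn_of_samples`: the third, "certified", form of the core hypothesis).
  LANDED (wave 1, p103735): `Theorems/WazewskiBlockUniformWorkFloorTrapStubWorkFallRate.lean`, wired below.
After wave 1 the file has exactly ONE `sorry`: the core `stub_loudGalerkinFamily`, which is equivalent to
the crux modulo the proved plumbing (crux ⇒ core (ii) by uniqueness of the Galerkin ODE,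
`IsGalerkinODESolution.eqOn`; core ⇒ crux = `UniformWorkFloorTrap_of`) — open-problem class (the zeroth
law of turbulence at Galerkin level: a ν-uniform pointwise injection floor at ν-uniformly bounded energy
for one steady force and every `ν ≤ ν₀`).

Disproof.lean for this crux: none published yet (`ledger crux ls` 2026-08-16T14:20Z shows no `Disproof.lean`).

LEAD c1 (prover-line-stmt-AnomalousDissipation-10353-c1-0), cycle 2 — the core stub is BRACKETED, kernel-checked:
* `Theorems/WazewskiBlockUniformWorkFloorTrapLoadBearing.lean` (p107806): `uniformWorkFloorTrap_iff_orbit`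
  (crux ⇔ disjunct (ii): ∃ trapped `galerkinFlow` orbit at every `(ν, N ≥ N₀(ν))` — the stub IS the crux in
  semiflow language), `dissipation_floor_of_trapped` (`ν∫₀ᵀ‖∇U‖² ≥ ε₀T − E`: crux ⇒ Galerkin zeroth law along
  its orbits), `resolution_floor_of_trapped` (`ε₀ ≤ 8π²νN²E`, i.e. `N₀(ν) ≥ (ε₀/8π²νE)^{1/2}`),
  `not_uniformWorkFloorTrap_fixedResolution` (STRONGER `∃N₀ ∀ν`: FALSE for every force);
* `Theorems/WazewskiBlockUniformWorkFloorTrapNuDependent.lean` (p108693): `uniformWorkFloorTrap_nuDependent` /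
  `nuDependentTrap_glue` (WEAKER `∀ν ∃E ε₀`: TRUE for every nonzero mean-zero Galerkin-mode force, `N₀ = m`,
  via Temam's steady Galerkin states and the `N`-uniform lower bound `‖f‖² ≤ M_f∫‖U‖² + ν‖Δf‖(∫‖U‖²)^{1/2}`).
  So the open content of `stub_loudGalerkinFamily` is exactly the ν-UNIFORMITY of `(E, ε₀)`; and since the
  laminar Kolmogorov state is a Galerkin steady state at every `N ≥ m` with `W = ‖f‖²/(4π²m²ν) → ∞` and
  `KE = ‖f‖²/(2(4π²m²ν)²)`, a ν-uniform FLOOR with ν-dependent cap is also trivial: the hard half is the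
  ν-uniform ENERGY CAP (cf. Correlation's bounded-energy cruxes), jointly with any positive floor.
* `Cruxes/UniformWorkFloorTrap/NegativeNaiveBlockInternalTangency.md`: the literal block `{KE ≤ E} ∩ {W ≥ ε₀}`
  (and 10352's capped block) has INTERNAL tangencies on both faces for `ν ≤ ν₁`, `N ≳ ν^{-1/2}` — it is not an
  isolating block and its immediate exit set is not closed, so `WazewskiRetract` cannot be applied to it.

LEAD c2 (prover-line-stmt-AnomalousDissipation-10353-c2-0), cycle 3 — skeleton re-registered from this seat's
folder, unchanged composition (one open stub, `stub_loudGalerkinFamily`, held by the lead; wave: none — 1 stub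
left). This cycle lands the crux's PDE-LEVEL consequences and its glue to the summit
(`Theorems/WazewskiBlockUniformWorkFloorTrapLerayHopf.lean`): the cap-free Hopf–Galerkin limit of a trapped
family (time-shifted data have `ν`-bounded enstrophy, so Rellich still gives strong convergence of the data),
`UniformWorkFloorTrap → ∀ ν ≤ ν₀ ∃` global Leray–Hopf `u` with `KE ≤ E`, `(f,u t) ≥ ε₀ ∀ t ≥ 0`,
`UniformWorkFloorTrap → Correlation.CorrelationPersistence` (cross-route: this rank-3 crux implies route
Correlation's rank-2 crux) and `UniformWorkFloorTrap → Correlation.NoMeanLeakage → AnomalousDissipation`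
(the "no-leakage statement" the planner asked for if only this crux closes is the EXISTING item
stmt-AnomalousDissipation-14265).
-/

noncomputable section

-- `Summit.<Summit>.<Problem>`: single-conjunct summit, the duplicate namespace is mandated (CONVENTIONS §2).
set_option linter.dupNamespace false

namespace Summit.AnomalousDissipation.AnomalousDissipation.Cruxes.UniformWorkFloorTrap.Sketch

open scoped InnerProductSpace
open MeasureTheory Filter Set UnitAddTorus
open Literature.Analysis.FunctionSpaces Literature.Analysis.FunctionSpaces.Torus
open Literature.Analysis.FluidPDE
open Summit.AnomalousDissipation.AnomalousDissipation.Theses.WazewskiBlock (UniformWorkFloorTrap)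

/-- The flat three-torus. -/
local notation "𝕋³" => UnitAddTorus (Fin 3)
/-- Velocity values on `T³`. -/
local notation "E³" => EuclideanSpace ℝ (Fin 3)

/-! ## The stubs -/

/-- **CORE STUB (hardest, open-problem class; held by the lead).** A mean-zero Galerkin-mode force
`f` of order `m`, constants `E, ε₀, ν₀ > 0` such that for every `0 < ν ≤ ν₀` there is `N₀` with, for
every `N ≥ N₀`, EITHER (i) a Galerkin steady state `U` of order `N` (tested steady Galerkin equations
against every Galerkin mode of order `N`) with `kineticEnergy U ≤ E` and `(f, U) ≥ ε₀`, OR (ii) for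
every horizon `n : ℕ` a Galerkin mode `a` of order `N` whose `galerkinFlow` orbit stays in
`{kineticEnergy ≤ E} ∩ {(f, ·) ≥ ε₀}` on `[0, n]`, OR (iii) the CERTIFIED form of (ii): for every horizon
`n` a Galerkin mode `a` of order `N ≥ m`, a stress budget `D ≥ 0` valid on the Galerkin modes of the
energy ball, a sampling step `h > 0`, the energy cap along the orbit on `[0, n]`, and the work margin
`(f, U(kh)) ≥ ε₀ + D h` at the sample times `kh ≤ n` only. (i) is what a nonzero Brouwer degree on the
block / a descended nondegenerate steady state delivers; (ii) what a loud periodic orbit, a loud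
attractor piece, or turbulence with `sup` exit time `= ∞` delivers; (iii) what validated numerics of one
orbit deliver. -/
theorem stub_loudGalerkinFamily :
    ∃ (m : ℕ) (f : 𝕋³ → E³), IsGalerkinMode m f ∧ HasZeroMean f ∧ ∃ (E ε₀ ν₀ : ℝ), 0 < ε₀ ∧ 0 < ν₀ ∧
      ∀ ν : ℝ, 0 < ν → ν ≤ ν₀ → ∃ N₀ : ℕ, ∀ N : ℕ, N₀ ≤ N →
        (∃ U : 𝕋³ → E³, IsGalerkinMode N U ∧
          (∀ a : 𝕋³ → E³, IsGalerkinMode N a →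
            ∫ x, (⟪U x, convect U a x⟫_ℝ + ν * ⟪U x, laplacian a x⟫_ℝ + ⟪f x, a x⟫_ℝ) = 0) ∧
          kineticEnergy U ≤ E ∧ ε₀ ≤ ∫ x, ⟪f x, U x⟫_ℝ) ∨
        (∀ n : ℕ, ∃ a : 𝕋³ → E³, IsGalerkinMode N a ∧ ∀ t ∈ Set.Icc (0 : ℝ) n,
          kineticEnergy (Torus.galerkinFlow ν f N t a) ≤ E ∧
            ε₀ ≤ ∫ x, ⟪f x, Torus.galerkinFlow ν f N t a x⟫_ℝ) ∨
        (m ≤ N ∧ ∀ n : ℕ, ∃ (a : 𝕋³ → E³) (D h : ℝ), IsGalerkinMode N a ∧ 0 ≤ D ∧ 0 < h ∧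
          (∀ V : 𝕋³ → E³, IsGalerkinMode N V → kineticEnergy V ≤ E →
            -D ≤ (∫ x, ⟪V x, convect V f x⟫_ℝ) + ν * (∫ x, ⟪V x, laplacian f x⟫_ℝ) +
              ∫ x, ‖f x‖ ^ 2) ∧
          (∀ t ∈ Set.Icc (0 : ℝ) n, kineticEnergy (Torus.galerkinFlow ν f N t a) ≤ E) ∧
          (∀ k : ℕ, (k : ℝ) * h ≤ n →
            ε₀ + D * h ≤ ∫ x, ⟪f x, Torus.galerkinFlow ν f N ((k : ℝ) * h) a x⟫_ℝ)) := by
  sorry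

/-- **Steady transfer (M).** A Galerkin steady state `U` of order `N` at viscosity `ν ≥ 0` with the
force `f ∈ L²` — a Galerkin mode annihilating the tested Galerkin equations against every Galerkin mode
of order `N` — lying in the block (`kineticEnergy U ≤ E`, `(f, U) ≥ ε₀`) yields a global Galerkin
trajectory of order `N` trapped in the block for all `t ≥ 0`: the constant curve `t ↦ U` (the steady
energy equation `ν‖∇U‖² = (f, U)` follows from the test `a := U`, since `∫⟪U,(U·∇)U⟫ = 0` and
`∫⟪U, ΔU⟫ = -‖∇U‖²`; cf. `Theorems.isGalerkinTrajectory_const_of_steady`). -/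
theorem stub_steadyTransfer :
    ∀ (ν : ℝ) (N : ℕ) (f U : 𝕋³ → E³) (E ε₀ : ℝ), 0 ≤ ν → MemLp f 2 volume → IsGalerkinMode N U →
      (∀ a : 𝕋³ → E³, IsGalerkinMode N a →
        ∫ x, (⟪U x, convect U a x⟫_ℝ + ν * ⟪U x, laplacian a x⟫_ℝ + ⟪f x, a x⟫_ℝ) = 0) →
      kineticEnergy U ≤ E → ε₀ ≤ ∫ x, ⟪f x, U x⟫_ℝ →
      ∃ V : ℝ → 𝕋³ → E³, Torus.IsGalerkinTrajectory ν f N V ∧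
        ∀ t : ℝ, 0 ≤ t → kineticEnergy (V t) ≤ E ∧ ε₀ ≤ ∫ x, ⟪f x, V t x⟫_ℝ :=
  Theorems.UniformWorkFloorTrap.Sketch.stub_steadyTransfer

/-- **Finite-horizon principle for the Galerkin semiflow (M/L).** For `ν ≥ 0`, `f ∈ L²` and the
block `B = {a Galerkin mode of order N | kineticEnergy a ≤ E, (f, a) ≥ ε₀}`: if for every horizon `n`
some orbit of `Torus.galerkinFlow ν f N` stays in `B` on `[0, n]`, then some orbit stays in `B` for all
`t ≥ 0`. Proof idea: in the finite-dimensional phase space `galerkinSubspace (freqBall N)` the block is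
closed and bounded (`kineticEnergy_realTrigPoly`), hence compact; the survivor sets
`K_n = {a ∈ B | orbit ⊂ B on [0,n]}` are closed (joint continuity, `galerkinPhaseFlow_semiflow`),
nested and nonempty, so `⋂ K_n ≠ ∅` (Cantor); conjugacy `Torus.galerkinFlow_realTrigPoly`. -/
theorem stub_finiteHorizon :
    ∀ (ν : ℝ) (N : ℕ) (f : 𝕋³ → E³) (E ε₀ : ℝ), 0 ≤ ν → MemLp f 2 volume →
      (∀ n : ℕ, ∃ a : 𝕋³ → E³, IsGalerkinMode N a ∧ ∀ t ∈ Set.Icc (0 : ℝ) n,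
        kineticEnergy (Torus.galerkinFlow ν f N t a) ≤ E ∧
          ε₀ ≤ ∫ x, ⟪f x, Torus.galerkinFlow ν f N t a x⟫_ℝ) →
      ∃ a : 𝕋³ → E³, IsGalerkinMode N a ∧ ∀ t : ℝ, 0 ≤ t →
        kineticEnergy (Torus.galerkinFlow ν f N t a) ≤ E ∧
          ε₀ ≤ ∫ x, ⟪f x, Torus.galerkinFlow ν f N t a x⟫_ℝ :=
  Theorems.UniformWorkFloorTrap.Sketch.stub_finiteHorizon

/-- **Work fall rate (M).** Along a global Galerkin trajectory `U` of order `N ≥ m` driven by a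
Galerkin-mode force `f` of order `m`, whose energy stays `≤ E` on `[s, t]`: if `-D` (`D ≥ 0`) bounds
from below the instantaneous work rate `∫⟪V,(V·∇)f⟫ + ν∫⟪V,Δf⟫ + ∫‖f‖²` on the Galerkin modes of the
energy ball `{kineticEnergy ≤ E}`, then `(f, U t) - (f, U s) ≥ -D (t - s)`. Proof idea: the tested
Galerkin identity with the admissible test field `a := f` (`IsGalerkinMode.mono`), splitting of the
space integral (all fields smooth), and monotonicity of the interval integral (a non-integrable rate
gives the integral `0 ≥ -D (t - s)`). -/
theorem stub_workFallRate :
    ∀ (ν : ℝ) (m N : ℕ) (f : 𝕋³ → E³) (E D : ℝ) (U : ℝ → 𝕋³ → E³) (s t : ℝ),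
      IsGalerkinMode m f → m ≤ N → Torus.IsGalerkinTrajectory ν f N U → 0 ≤ D → 0 ≤ s → s ≤ t →
      (∀ τ ∈ Set.Icc s t, kineticEnergy (U τ) ≤ E) →
      (∀ V : 𝕋³ → E³, IsGalerkinMode N V → kineticEnergy V ≤ E →
        -D ≤ (∫ x, ⟪V x, convect V f x⟫_ℝ) + ν * (∫ x, ⟪V x, laplacian f x⟫_ℝ) + ∫ x, ‖f x‖ ^ 2) →
      -(D * (t - s)) ≤ (∫ x, ⟪f x, U t x⟫_ℝ) - ∫ x, ⟪f x, U s x⟫_ℝ :=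
  Theorems.UniformWorkFloorTrap.Sketch.stub_workFallRate

/-! ## Proved glue -/

/-- **Earlier margins propagate (proved from `stub_workFallRate`).** Under the hypotheses of
`stub_workFallRate`, a margin `(f, U s) ≥ ε₀ + D (t - s)` at the earlier time gives the floor
`(f, U t) ≥ ε₀` at the later time — the one-step form of "certified samples + Lipschitz modulus ⇒
pointwise floor" by which clause (5) is verified from finitely many evaluations. -/
theorem workFloor_of_earlier {ν : ℝ} {m N : ℕ} {f : 𝕋³ → E³} {E D ε₀ : ℝ} {U : ℝ → 𝕋³ → E³}
    {s t : ℝ} (hf : IsGalerkinMode m f) (hmN : m ≤ N) (hU : Torus.IsGalerkinTrajectory ν f N U)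
    (hD : 0 ≤ D) (hs : 0 ≤ s) (hst : s ≤ t) (hE : ∀ τ ∈ Set.Icc s t, kineticEnergy (U τ) ≤ E)
    (hrate : ∀ V : 𝕋³ → E³, IsGalerkinMode N V → kineticEnergy V ≤ E →
      -D ≤ (∫ x, ⟪V x, convect V f x⟫_ℝ) + ν * (∫ x, ⟪V x, laplacian f x⟫_ℝ) + ∫ x, ‖f x‖ ^ 2)
    (hmargin : ε₀ + D * (t - s) ≤ ∫ x, ⟪f x, U s x⟫_ℝ) :
    ε₀ ≤ ∫ x, ⟪f x, U t x⟫_ℝ := by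
  have h := stub_workFallRate ν m N f E D U s t hf hmN hU hD hs hst hE hrate
  linarith

/-- **Forward orbits of the Galerkin semiflow are global Galerkin trajectories** (field level; the four
clauses by `IsGalerkinMode.galerkinFlow_clauses`, repackaged by `Torus.isGalerkinTrajectory_iff`). -/
theorem isGalerkinTrajectory_orbit {ν : ℝ} {N : ℕ} {f a : 𝕋³ → E³} (ha : IsGalerkinMode N a)
    (hν : 0 ≤ ν) (hf : MemLp f 2 volume) :
    Torus.IsGalerkinTrajectory ν f N (fun t => Torus.galerkinFlow ν f N t a) := by
  obtain ⟨-, h1, h2, h3, h4⟩ := ha.galerkinFlow_clauses hν hf (ν := ν)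
  exact Torus.isGalerkinTrajectory_iff.2 ⟨h1, h2, h3, h4⟩

/-- **A trapped forward orbit of the Galerkin semiflow is a witness of the crux's `∃ U`-body at
`(ν, N)`** (clauses (1)–(4) by `isGalerkinTrajectory_orbit`, clause (5) by hypothesis). -/
theorem body_of_forwardOrbit {ν : ℝ} {N : ℕ} {f a : 𝕋³ → E³} {E ε₀ : ℝ}
    (ha : IsGalerkinMode N a) (hν : 0 ≤ ν) (hf : MemLp f 2 volume)
    (hB : ∀ t : ℝ, 0 ≤ t → kineticEnergy (Torus.galerkinFlow ν f N t a) ≤ E ∧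
      ε₀ ≤ ∫ x, ⟪f x, Torus.galerkinFlow ν f N t a x⟫_ℝ) :
    ∃ U : ℝ → 𝕋³ → E³, Torus.IsGalerkinTrajectory ν f N U ∧
      ∀ t : ℝ, 0 ≤ t → kineticEnergy (U t) ≤ E ∧ ε₀ ≤ ∫ x, ⟪f x, U t x⟫_ℝ :=
  ⟨fun t => Torus.galerkinFlow ν f N t a, isGalerkinTrajectory_orbit ha hν hf, hB⟩

/-- **Certified samples give a sojourn (proved from `stub_workFallRate`).** Along the `galerkinFlow`
orbit of a Galerkin mode `a` of order `N ≥ m` (force `f` a Galerkin mode of order `m`): an energy cap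
`KE ≤ E` on `[0, n]`, a stress budget `D ≥ 0` on the Galerkin modes of the energy ball, and work
margins `(f, U(kh)) ≥ ε₀ + D h` at the sample times `kh ≤ n` (`h > 0`) give the block clause on all of
`[0, n]`: between samples the work falls by at most `D h` (`workFloor_of_earlier` from the last sample
time `⌊t/h⌋ h`). -/
theorem sojourn_of_samples {ν : ℝ} {m N : ℕ} {f a : 𝕋³ → E³} {E ε₀ D h : ℝ} {n : ℕ}
    (hf : IsGalerkinMode m f) (hmN : m ≤ N) (ha : IsGalerkinMode N a) (hν : 0 ≤ ν) (hD : 0 ≤ D)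
    (hh : 0 < h)
    (hrate : ∀ V : 𝕋³ → E³, IsGalerkinMode N V → kineticEnergy V ≤ E →
      -D ≤ (∫ x, ⟪V x, convect V f x⟫_ℝ) + ν * (∫ x, ⟪V x, laplacian f x⟫_ℝ) + ∫ x, ‖f x‖ ^ 2)
    (hE : ∀ t ∈ Set.Icc (0 : ℝ) n, kineticEnergy (Torus.galerkinFlow ν f N t a) ≤ E)
    (hW : ∀ k : ℕ, (k : ℝ) * h ≤ n →
      ε₀ + D * h ≤ ∫ x, ⟪f x, Torus.galerkinFlow ν f N ((k : ℝ) * h) a x⟫_ℝ) :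
    ∀ t ∈ Set.Icc (0 : ℝ) n, kineticEnergy (Torus.galerkinFlow ν f N t a) ≤ E ∧
      ε₀ ≤ ∫ x, ⟪f x, Torus.galerkinFlow ν f N t a x⟫_ℝ := by
  intro t ht
  refine ⟨hE t ht, ?_⟩
  have hfL2 : MemLp f 2 volume := hf.isSmooth.memLp 2
  have hU := isGalerkinTrajectory_orbit ha hν hfL2 (ν := ν)
  -- the last sample time `s = k h ≤ t < (k + 1) h`
  set k : ℕ := ⌊t / h⌋₊ with hk
  have hk1 : (k : ℝ) ≤ t / h := Nat.floor_le (div_nonneg ht.1 hh.le)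
  have hk2 : t / h < k + 1 := Nat.lt_floor_add_one (t / h)
  have hkT : (k : ℝ) * h ≤ t := by
    have := mul_le_mul_of_nonneg_right hk1 hh.le
    rwa [div_mul_cancel₀ t hh.ne'] at this
  have htT : t < (k + 1) * h := by
    have := mul_lt_mul_of_pos_right hk2 hh
    rwa [div_mul_cancel₀ t hh.ne'] at this
  have hs0 : (0 : ℝ) ≤ k * h := mul_nonneg (Nat.cast_nonneg k) hh.le
  have hsn : (k : ℝ) * h ≤ n := hkT.trans ht.2
  have hts : t - k * h ≤ h := by nlinarith
  refine workFloor_of_earlier (U := fun τ => Torus.galerkinFlow ν f N τ a) (ε₀ := ε₀) hf hmN hU hD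
    hs0 hkT (fun τ hτ => hE τ ⟨hs0.trans hτ.1, hτ.2.trans ht.2⟩) hrate ?_
  have hmargin := hW k hsn
  have : D * (t - k * h) ≤ D * h := mul_le_mul_of_nonneg_left hts hD
  linarith

/-- **The crux at one `(ν, N)` from any of the three kinds of witness** (steady state:
`stub_steadyTransfer`; long sojourns: `stub_finiteHorizon` + `body_of_forwardOrbit`; certified
sampled sojourns: `sojourn_of_samples` first). -/
theorem body_of_witness {ν : ℝ} {m N : ℕ} {f : 𝕋³ → E³} {E ε₀ : ℝ} (hν : 0 ≤ ν)
    (hf : IsGalerkinMode m f)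
    (h : (∃ U : 𝕋³ → E³, IsGalerkinMode N U ∧
          (∀ a : 𝕋³ → E³, IsGalerkinMode N a →
            ∫ x, (⟪U x, convect U a x⟫_ℝ + ν * ⟪U x, laplacian a x⟫_ℝ + ⟪f x, a x⟫_ℝ) = 0) ∧
          kineticEnergy U ≤ E ∧ ε₀ ≤ ∫ x, ⟪f x, U x⟫_ℝ) ∨
        (∀ n : ℕ, ∃ a : 𝕋³ → E³, IsGalerkinMode N a ∧ ∀ t ∈ Set.Icc (0 : ℝ) n,
          kineticEnergy (Torus.galerkinFlow ν f N t a) ≤ E ∧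
            ε₀ ≤ ∫ x, ⟪f x, Torus.galerkinFlow ν f N t a x⟫_ℝ) ∨
        (m ≤ N ∧ ∀ n : ℕ, ∃ (a : 𝕋³ → E³) (D h : ℝ), IsGalerkinMode N a ∧ 0 ≤ D ∧ 0 < h ∧
          (∀ V : 𝕋³ → E³, IsGalerkinMode N V → kineticEnergy V ≤ E →
            -D ≤ (∫ x, ⟪V x, convect V f x⟫_ℝ) + ν * (∫ x, ⟪V x, laplacian f x⟫_ℝ) +
              ∫ x, ‖f x‖ ^ 2) ∧
          (∀ t ∈ Set.Icc (0 : ℝ) n, kineticEnergy (Torus.galerkinFlow ν f N t a) ≤ E) ∧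
          (∀ k : ℕ, (k : ℝ) * h ≤ n →
            ε₀ + D * h ≤ ∫ x, ⟪f x, Torus.galerkinFlow ν f N ((k : ℝ) * h) a x⟫_ℝ))) :
    ∃ U : ℝ → 𝕋³ → E³, Torus.IsGalerkinTrajectory ν f N U ∧
      ∀ t : ℝ, 0 ≤ t → kineticEnergy (U t) ≤ E ∧ ε₀ ≤ ∫ x, ⟪f x, U t x⟫_ℝ := by
  have hfL2 : MemLp f 2 volume := hf.isSmooth.memLp 2
  rcases h with ⟨U, hU, hsteady, hE, hW⟩ | hsoj | ⟨hmN, hsam⟩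
  · exact stub_steadyTransfer ν N f U E ε₀ hν hfL2 hU hsteady hE hW
  · obtain ⟨a, ha, hB⟩ := stub_finiteHorizon ν N f E ε₀ hν hfL2 hsoj
    exact body_of_forwardOrbit ha hν hfL2 hB
  · have hsoj : ∀ n : ℕ, ∃ a : 𝕋³ → E³, IsGalerkinMode N a ∧ ∀ t ∈ Set.Icc (0 : ℝ) n,
        kineticEnergy (Torus.galerkinFlow ν f N t a) ≤ E ∧
          ε₀ ≤ ∫ x, ⟪f x, Torus.galerkinFlow ν f N t a x⟫_ℝ := by
      intro n
      obtain ⟨a, D, h, ha, hD, hh, hrate, hE, hW⟩ := hsam n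
      exact ⟨a, ha, sojourn_of_samples hf hmN ha hν hD hh hrate hE hW⟩
    obtain ⟨a, ha, hB⟩ := stub_finiteHorizon ν N f E ε₀ hν hfL2 hsoj
    exact body_of_forwardOrbit ha hν hfL2 hB

/-! ## The composition -/

/-- **The line closes the crux modulo its stubs**: `UniformWorkFloorTrap` from
`stub_loudGalerkinFamily` through `body_of_witness` (`stub_steadyTransfer`, `stub_finiteHorizon`) and
the dictionary `Torus.isGalerkinTrajectory_iff` (the crux inlines `IsGalerkinMode` and the four
trajectory clauses verbatim, so the repackaging is definitional). -/
theorem UniformWorkFloorTrap_of : UniformWorkFloorTrap := by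
  obtain ⟨m, f, hf, hf0, E, ε₀, ν₀, hε₀, hν₀, H⟩ := stub_loudGalerkinFamily
  refine ⟨m, f, hf, hf0, E, ε₀, ν₀, hε₀, hν₀, fun ν hν hνν₀ => ?_⟩
  obtain ⟨N₀, hN₀⟩ := H ν hν hνν₀
  refine ⟨N₀, fun N hN => ?_⟩
  obtain ⟨U, hU, hB⟩ := body_of_witness hν.le hf (hN₀ N hN)
  exact ⟨U, Torus.isGalerkinTrajectory_iff.1 hU, hB⟩

end Summit.AnomalousDissipation.AnomalousDissipation.Cruxes.UniformWorkFloorTrap.Sketch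

end
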